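import Summits.CriticalPhenomena.PercolationContinuityZ3.Theorems.PercAnnulusCrossingIICRootedEdgeObstacle
import HarnessLib

/-!
# The spatial Markov property of Kesten's IIC with respect to the cluster of the origin in a box (lane RSW3, p1 gen 8)

builds on p205010 (kernel theorem, internal audit signed; external expert review pending) — NOT used in this file.

RSW3 lane (LANE 3 `prim-rsw3`), seat `prim-rsw3-p1` (gen 8).  Helper file (`--supports stmt-CriticalPhenomena-4575`); no definitions, no sorries;
every `d`, every `p`.  Notation of `…IICRootedEdgeObstacle` §4: `V ∋ 0`, `V ⊆ Λ(m)`, connected through the set `G` of pairs inside `V`; `F` = the pairs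
from `V` to `Λ(m) ∖ V`; `CL_m(V) = {F closed} ∩ {0 ↔ v inside V, ∀ v ∈ V}` ('the open cluster of `0` in `Λ(m)` is `V`'); `C = {F closed, G open}`.

* `inter_clusterBox_inter_siteToBoundary_eq` — on `CL_m(V)`, for `E` off `F ∪ V.sym2`: `E ∩ CL ∩ A_n = CL ∩ (E ∩ CONN_{F ∪ V.sym2}(V;n))`;
* `real_inter_clusterBox_inter_siteToBoundary_eq` — `P_p(E ∩ CL_m(V) ∩ A_n) = P_p(CL_m(V)) · P_p(E ∩ CONN_F(V;n))` (independence + dropping the internal pairs);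
* **`iicMeasure_real_inter_clusterBox_mul_eq`** — THE SPATIAL MARKOV PROPERTY: for every measure `ν` with Kesten's IIC limit property and every `E`
  determined by finitely many pairs off `F ∪ V.sym2`:  **`ν(E ∩ CL_m(V)) · ν(C) = ν(CL_m(V)) · ν(E ∩ C)`**, i.e. `ν(E | the cluster of 0 in Λ(m) is V)
  = ν(E | ∂V closed, V's edges open)`: conditionally on the cluster of the origin in `Λ(m)`, the IIC outside it depends on the cluster only through
  `(V, ∂V)` — the internal open/closed pattern is forgotten — and is the IIC rooted at `V` off `∂V` (`…IICRootedEdgeObstacle` §3).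
References: H. Kesten, PTRF 73 (1986) §2; D. Basu, A. Sapozhnikov, ECP 22 (2017) no. 26, Thm 1.1 and Remark 2.1; G. Grimmett, *Percolation* (1999), §2.2.
-/

noncomputable section

namespace Summit.CriticalPhenomena.PercolationContinuityZ3.Theorems.Crossing

open MeasureTheory Filter Topology Literature.Probability.Percolation Literature.Probability.LatticeModels
open Literature.Probability.Percolation.DCT16

variable {d : ℕ}

/-- `P_p(E ∩ CL_m(V) ∩ A_n) = P_p(CL_m(V)) · P_p(E ∩ CONN_F(V;n))` for `n > m` and `E` measurable, determined by a set of pairs disjoint from `F ∪ V.sym2`.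
[cite: Kesten1986, §2 (2.16)] -/
theorem real_inter_clusterBox_inter_siteToBoundary_eq (p : unitInterval) {m n : ℕ} (hmn : m < n) {V : Finset (Site d)} (hVm : V ⊆ box d m)
    (h0 : (0 : Site d) ∈ V) {F : Finset (Sym2 (Site d))} (hF : ∀ e, e ∈ F ↔ ∃ a ∈ V, ∃ b ∈ box d m, b ∉ V ∧ e = s(a, b))
    {E : Set (BondConfig (Site d))} (hEm : MeasurableSet E) {T : Set (Sym2 (Site d))} (hE : DeterminedBy E T)
    (hT : Disjoint T ↑(F ∪ V.sym2)) :
    (bondPercolation (zdGraph d) p).real (E ∩ ({ω : BondConfig (Site d) | ∀ e ∈ F, e ∉ ω} ∩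
        {ω | ∀ v ∈ V, ω ∈ openConnIn (↑V : Set (Site d)) 0 v}) ∩ siteToBoundary d n) =
      (bondPercolation (zdGraph d) p).real ({ω : BondConfig (Site d) | ∀ e ∈ F, e ∉ ω} ∩
          {ω | ∀ v ∈ V, ω ∈ openConnIn (↑V : Set (Site d)) 0 v}) *
        (bondPercolation (zdGraph d) p).real (E ∩ {ω : BondConfig (Site d) | ∃ x ∈ V, ∃ t ∈ innerBoundary (zdGraph d) (box d n),
          ω \ (↑F : Set (Sym2 (Site d))) ∈ openConnIn (↑(box d n) : Set (Site d)) x t}) := by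
  classical
  set μ := bondPercolation (zdGraph d) p with hμ
  set CL := ({ω : BondConfig (Site d) | ∀ e ∈ F, e ∉ ω} ∩ {ω | ∀ v ∈ V, ω ∈ openConnIn (↑V : Set (Site d)) 0 v}) with hCLdef
  have hVsym : ∀ e ∈ V.sym2, ∀ v ∈ e, v ∈ V := fun e he v hv => by rw [Finset.mem_sym2_iff] at he; exact he v hv
  -- set identity
  have hset : E ∩ CL ∩ siteToBoundary d n = CL ∩ (E ∩ {ω : BondConfig (Site d) | ∃ x ∈ V, ∃ t ∈ innerBoundary (zdGraph d) (box d n),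
      ω \ (↑(F ∪ V.sym2) : Set (Sym2 (Site d))) ∈ openConnIn (↑(box d n) : Set (Site d)) x t}) := by
    rw [Set.inter_assoc, clusterBox_inter_siteToBoundary_eq hmn hVm h0 hF, Set.inter_left_comm]
  -- determining sets
  have hCLdet : DeterminedBy CL (↑(F ∪ V.sym2) : Set (Sym2 (Site d))) := by
    rw [Finset.coe_union]
    refine (determinedBy_forall_notMem F).mono Set.subset_union_left |>.inter ?_
    have h : {ω : BondConfig (Site d) | ∀ v ∈ V, ω ∈ openConnIn (↑V : Set (Site d)) 0 v} = ⋂ v ∈ V, openConnIn (↑V : Set (Site d)) 0 v := by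
      ext ω; simp only [Set.mem_setOf_eq, Set.mem_iInter]
    rw [h, determinedBy_iff]
    intro ω ω' hωω'
    simp only [Set.mem_iInter]
    refine forall₂_congr fun v _ => ?_
    have hdet := determinedBy_openConnIn (↑V : Set (Site d)) (0 : Site d) v (K := (↑F : Set (Sym2 (Site d))) ∪ ↑V.sym2)
      (by rw [Finset.coe_sym2]; exact Set.subset_union_right)
    exact (determinedBy_iff _ _).1 hdet ω ω' hωω'
  have hEdet : DeterminedBy (E ∩ {ω : BondConfig (Site d) | ∃ x ∈ V, ∃ t ∈ innerBoundary (zdGraph d) (box d n),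
      ω \ (↑(F ∪ V.sym2) : Set (Sym2 (Site d))) ∈ openConnIn (↑(box d n) : Set (Site d)) x t}) (↑(F ∪ V.sym2) : Set (Sym2 (Site d)))ᶜ :=
    (hE.mono (Set.subset_compl_iff_disjoint_right.2 hT)).inter (determinedBy_connOff V (F ∪ V.sym2) n)
  rw [hset, bondPercolation_real_inter_of_disjoint (zdGraph d) p disjoint_compl_right hCLdet hEdet hCLdet.measurableSet_of_finset
    (hEm.inter (measurableSet_connOff V (F ∪ V.sym2) n)), connOff_union_eq_connOff (F := F) hVsym n]

/-- **THE SPATIAL MARKOV PROPERTY OF KESTEN'S IIC.**  For `V ∋ 0`, `V ⊆ Λ(m)`, connected through a set `G` of pairs inside `V`, `F` the pairs from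
`V` to `Λ(m) ∖ V`, every measure `ν` with Kesten's IIC limit property at `p`, and every `E` determined by finitely many pairs off `F ∪ V.sym2`:
**`ν(E ∩ CL_m(V)) · ν(C) = ν(CL_m(V)) · ν(E ∩ C)`**, `CL_m(V) = {F closed} ∩ {0 ↔ v in V ∀ v}`, `C = {F closed, G open}` — conditionally on 'the
cluster of the origin in `Λ(m)` is `V`', the configuration outside depends on the cluster only through `(V, ∂V)` and is `ν(· | ∂V closed, G open)`,
the IIC rooted at `V` off `∂V`.  (Both sides are `P_p(CL_m(V)) · ν(E ∩ C) · ν(C)/P_p(C)` by the rooted identity.)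
[cite: Kesten1986, Thm. (3) and §2 (2.16)] [cite: BasuSapozhnikov2017ECP, Thm. 1.1 and Remark 2.1] -/
theorem iicMeasure_real_inter_clusterBox_mul_eq (p : unitInterval) {ν : Measure (BondConfig (Site d))}
    (hν : ∀ (F : Finset (Sym2 (Site d))) (E : Set (BondConfig (Site d))), MeasurableSet E → DeterminedBy E ↑F →
      Tendsto (fun n : ℕ => (bondPercolation (zdGraph d) p).real (E ∩ siteToBoundary d n) / oneArmProb d p n)
        atTop (𝓝 (ν.real E)))
    {m : ℕ} {V : Finset (Site d)} (hVm : V ⊆ box d m) (h0 : (0 : Site d) ∈ V)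
    {F G : Finset (Sym2 (Site d))} (hF : ∀ e, e ∈ F ↔ ∃ a ∈ V, ∃ b ∈ box d m, b ∉ V ∧ e = s(a, b))
    (hG : ∀ e ∈ G, ∀ v ∈ e, v ∈ V) (hVconn : ∀ v ∈ V, PathIn (openGraph (↑G : Set (Sym2 (Site d)))) (↑V : Set (Site d)) 0 v)
    {E : Set (BondConfig (Site d))} {T : Finset (Sym2 (Site d))} (hE : DeterminedBy E ↑T) (hT : Disjoint T (F ∪ V.sym2)) :
    ν.real (E ∩ ({ω : BondConfig (Site d) | ∀ e ∈ F, e ∉ ω} ∩ {ω | ∀ v ∈ V, ω ∈ openConnIn (↑V : Set (Site d)) 0 v})) *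
        ν.real {ω : BondConfig (Site d) | (∀ e ∈ F, e ∉ ω) ∧ ∀ e ∈ G, e ∈ ω} =
      ν.real ({ω : BondConfig (Site d) | ∀ e ∈ F, e ∉ ω} ∩ {ω | ∀ v ∈ V, ω ∈ openConnIn (↑V : Set (Site d)) 0 v}) *
        ν.real (E ∩ {ω : BondConfig (Site d) | (∀ e ∈ F, e ∉ ω) ∧ ∀ e ∈ G, e ∈ ω}) := by
  classical
  set μ := bondPercolation (zdGraph d) p with hμ
  set CL := ({ω : BondConfig (Site d) | ∀ e ∈ F, e ∉ ω} ∩ {ω | ∀ v ∈ V, ω ∈ openConnIn (↑V : Set (Site d)) 0 v}) with hCLdef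
  set C := {ω : BondConfig (Site d) | (∀ e ∈ F, e ∉ ω) ∧ ∀ e ∈ G, e ∈ ω} with hCdef
  have hGsym : G ⊆ V.sym2 := fun e he => Finset.mem_sym2_iff.2 (hG e he)
  have hTK : Disjoint T (F ∪ G) := hT.mono_right (Finset.union_subset_union (subset_refl F) hGsym)
  have hEm : MeasurableSet E := hE.measurableSet_of_finset
  -- determining set of `CL`
  have hCLdet : DeterminedBy CL (↑(F ∪ V.sym2) : Set (Sym2 (Site d))) := by
    rw [Finset.coe_union]
    refine (determinedBy_forall_notMem F).mono Set.subset_union_left |>.inter ?_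
    have h : {ω : BondConfig (Site d) | ∀ v ∈ V, ω ∈ openConnIn (↑V : Set (Site d)) 0 v} = ⋂ v ∈ V, openConnIn (↑V : Set (Site d)) 0 v := by
      ext ω; simp only [Set.mem_setOf_eq, Set.mem_iInter]
    rw [h, determinedBy_iff]
    intro ω ω' hωω'
    simp only [Set.mem_iInter]
    refine forall₂_congr fun v _ => ?_
    have hdet := determinedBy_openConnIn (↑V : Set (Site d)) (0 : Site d) v (K := (↑F : Set (Sym2 (Site d))) ∪ ↑V.sym2)
      (by rw [Finset.coe_sym2]; exact Set.subset_union_right)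
    exact (determinedBy_iff _ _).1 hdet ω ω' hωω'
  have hECLdet : DeterminedBy (E ∩ CL) (↑(T ∪ (F ∪ V.sym2)) : Set (Sym2 (Site d))) := by
    rw [Finset.coe_union]
    exact (hE.mono Set.subset_union_left).inter (hCLdet.mono Set.subset_union_right)
  -- trivial case `P(C) = 0`
  by_cases hC : μ.real C = 0
  · have hνEC : ν.real (E ∩ C) = 0 := by
      have hECdet : DeterminedBy (E ∩ C) (↑(T ∪ (F ∪ G)) : Set (Sym2 (Site d))) := by
        rw [Finset.coe_union]; exact (hE.mono Set.subset_union_left).inter ((determinedBy_cyl F G).mono Set.subset_union_right)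
      have hlim := hν _ _ hECdet.measurableSet_of_finset hECdet
      refine tendsto_nhds_unique hlim (tendsto_const_nhds.congr' (Eventually.of_forall fun n => ?_))
      have h0' : μ.real (E ∩ C ∩ siteToBoundary d n) = 0 :=
        le_antisymm ((measureReal_mono (fun ω hω => hω.1.2) (measure_ne_top μ _)).trans hC.le) measureReal_nonneg
      simp only [h0', zero_div]
    have hνC : ν.real C = 0 := by
      have hlim := hν (F ∪ G) C (determinedBy_cyl F G).measurableSet_of_finset (determinedBy_cyl F G)
      refine tendsto_nhds_unique hlim (tendsto_const_nhds.congr' (Eventually.of_forall fun n => ?_))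
      have h0' : μ.real (C ∩ siteToBoundary d n) = 0 :=
        le_antisymm ((measureReal_mono Set.inter_subset_left (measure_ne_top μ _)).trans hC.le) measureReal_nonneg
      simp only [h0', zero_div]
    rw [hνEC, hνC, mul_zero, mul_zero]
  have hCpos : 0 < μ.real C := lt_of_le_of_ne measureReal_nonneg (Ne.symm hC)
  -- `ν(E ∩ CL) = P(CL) · ν(E ∩ C)/P(C)`
  have hlimE : Tendsto (fun n : ℕ => μ.real (E ∩ {ω : BondConfig (Site d) | ∃ x ∈ V, ∃ t ∈ innerBoundary (zdGraph d) (box d n),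
      ω \ (↑F : Set (Sym2 (Site d))) ∈ openConnIn (↑(box d n) : Set (Site d)) x t}) / oneArmProb d p n)
      atTop (𝓝 (ν.real (E ∩ C) / μ.real C)) := by
    have hECdet : DeterminedBy (E ∩ C) (↑(T ∪ (F ∪ G)) : Set (Sym2 (Site d))) := by
      rw [Finset.coe_union]; exact (hE.mono Set.subset_union_left).inter ((determinedBy_cyl F G).mono Set.subset_union_right)
    have hlim := hν _ _ hECdet.measurableSet_of_finset hECdet
    refine (hlim.div_const (μ.real C)).congr' ?_
    filter_upwards [eventually_ge_atTop m] with n hn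
    rw [← real_inter_connOff_mul_real_cyl_eq p hG h0 hVconn (hVm.trans (box_mono d hn)) hEm hE (Finset.disjoint_coe.2 hTK),
      div_right_comm, mul_div_assoc, div_self hC, mul_one]
  have hνECL : ν.real (E ∩ CL) = μ.real CL * (ν.real (E ∩ C) / μ.real C) := by
    have hlim := hν _ _ hECLdet.measurableSet_of_finset hECLdet
    refine tendsto_nhds_unique hlim ((hlimE.const_mul (μ.real CL)).congr' ?_)
    filter_upwards [eventually_gt_atTop m] with n hn
    rw [← mul_div_assoc, real_inter_clusterBox_inter_siteToBoundary_eq p hn hVm h0 hF hEm hE (Finset.disjoint_coe.2 hT)]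
  -- `ν(CL) = P(CL) · ν(C)/P(C)` (the cluster law), then algebra
  have hνCL := iicMeasure_real_clusterBox_mul_eq p hν hVm h0 hF hG hVconn
  have hνCL' : ν.real CL = μ.real CL * ν.real C / μ.real C := by
    rw [eq_div_iff hC]; exact hνCL
  rw [hνECL, hνCL']
  field_simp

end Summit.CriticalPhenomena.PercolationContinuityZ3.Theorems.Crossing
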